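import Summits.MatrixMultiplication.MatrixMultiplication.Theorems.AbelianSTPPCensusTAStatDefs

/-!
# T_A certificate past 1700 (static t*-indexed linear checker): kernel evaluation, domination of the table, volumes `1 … 1642`

Cell mm-stpp (rung F-M1), threshold T_A = `τ = 2.371`; checker and design in `AbelianSTPPCensusTAStatDefs.lean`, table in
`AbelianSTPPCensusTAStatData.lean`.  `decide` with kernel reduction (standard axioms; no `native_decide`), `Elab.async false`, one theorem per
chunk of volumes; consumed by `TAStat.checkV_sound` / `TAStat.domV_sound` (`AbelianSTPPCensusTAStatRows.lean`) in the leaf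
`AbelianSTPPCensusLeafTA5000Closed.lean`.
WHAT THIS IS NOT: arithmetic on shape lists only; no statement about STPP families or `ω`.
-/

set_option linter.dupNamespace false
set_option autoImplicit false
set_option Elab.async false

namespace Summit.MatrixMultiplication.MatrixMultiplication.Theorems.TAStat

open TAStatData (nl nb) in
/-- The structural facts about the table data (`monoOK`): row lengths, positive denominators, monotone fractions, bucket arithmetic. [original] -/
theorem mono_ok : monoOK TAStatData.nl TAStatData.nb = true := by decide +kernel

set_option maxHeartbeats 0 in
/-- Domination chunk: every sorted candidate shape of the volumes `1 … 528` (2608 shapes) is dominated by the table (`domX`). [original] -/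
theorem dom1 : domV 528 1 = true := by decide +kernel

set_option maxHeartbeats 0 in
/-- Domination chunk: every sorted candidate shape of the volumes `529 … 928` (2604 shapes) is dominated by the table (`domX`). [original] -/
theorem dom529 : domV 400 529 = true := by decide +kernel

set_option maxHeartbeats 0 in
/-- Domination chunk: every sorted candidate shape of the volumes `929 … 1296` (2637 shapes) is dominated by the table (`domX`). [original] -/
theorem dom929 : domV 368 929 = true := by decide +kernel

set_option maxHeartbeats 0 in
/-- Domination chunk: every sorted candidate shape of the volumes `1297 … 1642` (2600 shapes) is dominated by the table (`domX`). [original] -/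
theorem dom1297 : domV 346 1297 = true := by decide +kernel

end Summit.MatrixMultiplication.MatrixMultiplication.Theorems.TAStat
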